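import Summits.SmoothPoincare4.SmoothPoincare4.Theses.ConvexBisection
import Summits.SmoothPoincare4.SmoothPoincare4.Theorems.ConvexBisectionContractibleTwistedDoubleStandardStubSeam
import Literature.Geometry.Symplectic.PlanarContactBoundary
import Literature.Geometry.Symplectic.BoundaryContactomorphism
import Literature.Topology.FourManifolds.CerfGammaFourProofs
import HarnessLib

/-!
# Stub `stub_planarSeamTransfer` of line `coloured-string-links-square-free-ac` for crux
# `ConvexBisection.PlanarBisectionRigidity` (item stmt-SmoothPoincare4-10511)

**Planarity of the contact seam passes from `(∂W₁, ξ₁)` to `(∂W₂, ξ₂)`.**  Let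
`M = e₁(W₁) ∪ e₂(W₂)` be a Stein bisection of a `4`-manifold along a common contact seam: two
compact Stein domains `(Wᵢ, Jᵢ)` smoothly embedded in `M`, images covering `M` and meeting exactly
in the images of the two boundaries, with the pushed-forward complex tangencies
`deᵢ (contactPlane Jᵢ.J)` equal at common points.  If the contact boundary of `(W₁, J₁)` is planar
(`PlanarContactBoundary J₁`: some boundary datum `b₁` of `W₁` carries a planar open book supporting
the pulled-back complex tangencies `boundaryPlaneField J₁.J b₁`), then so is the contact boundary
of `(W₂, J₂)`.

Proof (the SAME carrier and the SAME open book, only the inclusion changes).  The landed seam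
theorem `…ContractibleTwistedDoubleStandard.LegendrianRKnotRigidity.stub_seam` gives, for `b₁` and
any boundary datum `b₂` of `W₂` (we take the subtype `∂W₂`,
`Literature.Topology.FourManifolds.BoundaryManifold.boundaryData`), the seam diffeomorphism
`ψ : b₁.carrier ≅ b₂.carrier` with `e₂ ∘ incl₂ ∘ ψ = e₁ ∘ incl₁` which is a contactomorphism
(`Literature.Geometry.Symplectic.IsContacto`: `d(incl₂ ∘ ψ) v ∈ ξ₂ ↔ d(incl₁) v ∈ ξ₁`).  The
transported boundary datum `b₂' := ⟨b₁.carrier, incl₂ ∘ ψ⟩` of `W₂` (a smooth embedding onto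
`∂W₂`: `Manifold.IsSmoothEmbedding.comp_diffeomorph`) has the same carrier as `b₁`, and by the
contactomorphism clause `boundaryPlaneField J₂.J b₂' = boundaryPlaneField J₁.J b₁` pointwise; so the
planar open book of `b₁.carrier` supporting the latter supports the former.  `stub_seam` is stated
for a compact ambient manifold; `M = range e₁ ∪ range e₂` is compact as a union of two continuous
images of compact spaces.  Geiges, *An Introduction to Contact Topology* (2008), §2.1
(contactomorphisms transport supporting open books tautologically); all standard. [folklore]
-/

noncomputable section

-- the prescribed namespace `Summit.<P>.<Sub>.…` duplicates `SmoothPoincare4` (P = Sub = SmoothPoincare4)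
set_option linter.dupNamespace false

open scoped Manifold ContDiff Topology
open Set Function Literature.Geometry.Symplectic Literature.Topology.FourManifolds

namespace Summit.SmoothPoincare4.SmoothPoincare4.Theorems.PlanarBisectionRigidity.ColouredStringLinksSquareFreeAc

/-- Local notation (as in the line's skeleton, so that the registered stub signature is matched
verbatim): the model space `ℝ⁴`. -/
local notation "E4" => EuclideanSpace ℝ (Fin 4)

/-- **Transport of a supported planar open book along a contactomorphic re-embedding of the
carrier.**  If `b₁` is a boundary datum of `W₁`, `b₂` one of `W₂`, and
`ψ : b₁.carrier ≅ b₂.carrier` is a diffeomorphism which is a contactomorphism for the complex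
tangencies of `J₁`, `J₂` (`IsContacto J₁ J₂ b₁ b₂ ψ`), then every open book of `b₁.carrier`
supporting `boundaryPlaneField J₁.J b₁` is, verbatim, an open book of the carrier of the boundary
datum `⟨b₁.carrier, b₂.incl ∘ ψ⟩` of `W₂` supporting its plane field; in particular planarity of
the contact boundary passes from `J₁` to `J₂`.  Geiges (2008), §2.1. [folklore] -/
theorem planarContactBoundary_of_isContacto
    {W₁ : Type} [TopologicalSpace W₁] [ChartedSpace (EuclideanHalfSpace 4) W₁]
    [IsManifold (𝓡∂ 4) ∞ W₁] [CompactSpace W₁]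
    {W₂ : Type} [TopologicalSpace W₂] [ChartedSpace (EuclideanHalfSpace 4) W₂]
    [IsManifold (𝓡∂ 4) ∞ W₂] [CompactSpace W₂]
    {J₁ : SteinStructure W₁} {J₂ : SteinStructure W₂}
    {b₁ : BoundaryData (𝓡∂ 4) W₁ (𝓡 3)} {b₂ : BoundaryData (𝓡∂ 4) W₂ (𝓡 3)}
    (ψ : b₁.carrier ≃ₘ⟮𝓡 3, 𝓡 3⟯ b₂.carrier) (hψ : IsContacto J₁ J₂ b₁ b₂ ψ)
    (ob : OpenBook b₁.carrier) (hplanar : ob.IsPlanar)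
    (hsup : ob.Supports (boundaryPlaneField J₁.J b₁)) :
    PlanarContactBoundary J₂ := by
  -- the transported boundary datum of `W₂`: same carrier as `b₁`, inclusion `incl₂ ∘ ψ`
  let b₂' : BoundaryData (𝓡∂ 4) W₂ (𝓡 3) :=
    { carrier := b₁.carrier
      incl := b₂.incl ∘ ψ
      isSmoothEmbedding := b₂.isSmoothEmbedding.comp_diffeomorph ψ
      range_incl := by rw [EquivLike.range_comp]; exact b₂.range_incl }
  -- its plane field is that of `b₁`, by the contactomorphism clause
  have key : boundaryPlaneField J₂.J b₂' = boundaryPlaneField J₁.J b₁ := by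
    funext y
    ext v
    rw [mem_boundaryPlaneField_iff, mem_boundaryPlaneField_iff]
    exact hψ y v
  refine ⟨b₂', ob, hplanar, ?_⟩
  rw [key]
  exact hsup

/-- **Stub `stub_planarSeamTransfer` (SUPPORT): planarity of the contact seam passes from
`(∂W₁, ξ₁)` to `(∂W₂, ξ₂)`.**  Under the bisection hypotheses of the crux (two compact Stein
domains smoothly embedded in `M`, ranges covering `M` and meeting exactly in the images of the two
boundaries, pushed-forward complex tangencies equal on the seam),
`PlanarContactBoundary J₁ → PlanarContactBoundary J₂`: the seam map `ψ = e₂⁻¹ ∘ e₁|∂W₁`, read on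
boundary data, is a contactomorphic diffeomorphism (`stub_seam` of crux
`ContractibleTwistedDoubleStandard`, which wants `M` compact — it is, as the union of the two
compact images), and a planar open book supporting `ξ₁` on the carrier of `b₁` supports `ξ₂` pulled
back along `incl₂ ∘ ψ` (`planarContactBoundary_of_isContacto`).  Geiges, *An Introduction to
Contact Topology* (2008), §2.1. [folklore] -/
theorem stub_planarSeamTransfer
    (M : Type) [TopologicalSpace M] [T2Space M] [SecondCountableTopology M] [ChartedSpace E4 M]
    [IsManifold (𝓡 4) ∞ M]
    (W₁ : Type) [TopologicalSpace W₁] [ChartedSpace (EuclideanHalfSpace 4) W₁] [IsManifold (𝓡∂ 4) ∞ W₁]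
    [CompactSpace W₁] (W₂ : Type) [TopologicalSpace W₂] [ChartedSpace (EuclideanHalfSpace 4) W₂]
    [IsManifold (𝓡∂ 4) ∞ W₂] [CompactSpace W₂] (J₁ : SteinStructure W₁) (J₂ : SteinStructure W₂)
    (e₁ : W₁ → M) (e₂ : W₂ → M)
    (he₁ : Manifold.IsSmoothEmbedding (𝓡∂ 4) (𝓡 4) ∞ e₁)
    (he₂ : Manifold.IsSmoothEmbedding (𝓡∂ 4) (𝓡 4) ∞ e₂)
    (hcover : range e₁ ∪ range e₂ = univ)
    (hseam₁ : range e₁ ∩ range e₂ = e₁ '' (𝓡∂ 4).boundary W₁)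
    (hseam₂ : range e₁ ∩ range e₂ = e₂ '' (𝓡∂ 4).boundary W₂)
    (hξ : ∀ w₁ w₂, e₁ w₁ = e₂ w₂ →
      Submodule.map (mfderiv (𝓡∂ 4) (𝓡 4) e₁ w₁).toLinearMap (contactPlane J₁.J w₁) =
      Submodule.map (mfderiv (𝓡∂ 4) (𝓡 4) e₂ w₂).toLinearMap (contactPlane J₂.J w₂))
    (hpl : PlanarContactBoundary J₁) :
    PlanarContactBoundary J₂ := by
  obtain ⟨b₁, ob, hplanar, hsup⟩ := hpl
  -- `M` is compact: the union of the two compact images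
  haveI : CompactSpace M := ⟨by
    rw [← hcover]
    exact (isCompact_range he₁.isEmbedding.continuous).union
      (isCompact_range he₂.isEmbedding.continuous)⟩
  -- any boundary datum of `W₂`: the subtype `∂W₂` with the restricted boundary charts
  let b₂ : BoundaryData (𝓡∂ 4) W₂ (𝓡 3) := BoundaryManifold.boundaryData 3 W₂
  -- the seam contactomorphism `ψ = incl₂⁻¹ ∘ e₂⁻¹ ∘ e₁ ∘ incl₁`
  obtain ⟨ψ, -, hcont⟩ :=
    Summit.SmoothPoincare4.SmoothPoincare4.Theorems.ContractibleTwistedDoubleStandard.LegendrianRKnotRigidity.stub_seam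
      M W₁ W₂ J₁ J₂ e₁ e₂ he₁ he₂ hseam₁ hseam₂ hξ b₁ b₂
  exact planarContactBoundary_of_isContacto ψ hcont ob hplanar hsup

end Summit.SmoothPoincare4.SmoothPoincare4.Theorems.PlanarBisectionRigidity.ColouredStringLinksSquareFreeAc

end
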